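import Mathlib

/-!
# CORE-A of crux `TameOrBrodyR4` (stmt-SmoothPoincare4-7826), line `Sketch`: the Fredholm step
# (lead c6, assembly layer A3)

The linearisation of the vorticity-form nonlinear Cauchy–Riemann map at the base member is
`1 + K` with `K` compact (`…CoreAOperators.lean`) and injective (the decaying-kernel theorem
`helper_decayingKernelZero`). Mathlib's Fredholm alternative
(`IsCompactOperator.hasEigenvalue_or_mem_resolventSet`: for compact `T` and `μ ≠ 0`, either `μ` is
an eigenvalue or `T - μ • 1` is invertible) then makes `1 + K` a Banach-space isomorphism — the
invertibility input of the implicit function theorem. Pure functional analysis over `ℝ`.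
-/

-- the registered namespace `Summit.SmoothPoincare4.SmoothPoincare4.…` repeats a component
set_option linter.dupNamespace false

noncomputable section

namespace Summit.SmoothPoincare4.SmoothPoincare4.Cruxes.TameOrBrodyR4.Sketch

namespace CoreA

variable {Y : Type*} [NormedAddCommGroup Y] [NormedSpace ℝ Y] [CompleteSpace Y]

/-- **Fredholm alternative, `1 + compact` form**: if `K` is a compact operator on a real Banach
space and `1 + K` is injective, then `1 + K` is a continuous linear equivalence. -/
theorem exists_continuousLinearEquiv_one_add (K : Y →L[ℝ] Y) (hK : IsCompactOperator K)
    (hinj : ∀ x : Y, x + K x = 0 → x = 0) :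
    ∃ L : Y ≃L[ℝ] Y, ∀ x : Y, L x = x + K x := by
  have hμ : (-1 : ℝ) ≠ 0 := by norm_num
  -- `-1` is not an eigenvalue of `K`
  have hne : ¬ Module.End.HasEigenvalue (K : Module.End ℝ Y) (-1) := by
    intro h
    obtain ⟨x, hx⟩ := h.exists_hasEigenvector
    have hx1 := hx.apply_eq_smul
    have hx0 : x = 0 := hinj x (by
      have : (K : Module.End ℝ Y) x = K x := rfl
      rw [← this, hx1]; simp)
    exact hx.2 hx0
  rcases hK.hasEigenvalue_or_mem_resolventSet hμ with h | h
  · exact absurd h hne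
  · -- `-1 ∈ resolventSet`: `algebraMap (-1) - K = -(1 + K)` is a unit
    rw [spectrum.mem_resolventSet_iff] at h
    have hunit : IsUnit ((1 : Y →L[ℝ] Y) + K) := by
      have heq : (algebraMap ℝ (Y →L[ℝ] Y) (-1) - K) = -((1 : Y →L[ℝ] Y) + K) := by
        rw [Algebra.algebraMap_eq_smul_one]; simp; abel
      rw [heq] at h
      exact (IsUnit.neg_iff _).mp h
    obtain ⟨u, hu⟩ := hunit
    refine ⟨ContinuousLinearEquiv.unitsEquiv ℝ Y u, fun x => ?_⟩
    have : ((ContinuousLinearEquiv.unitsEquiv ℝ Y u : Y ≃L[ℝ] Y) : Y →L[ℝ] Y) = (u : Y →L[ℝ] Y) :=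
      rfl
    rw [show (ContinuousLinearEquiv.unitsEquiv ℝ Y u) x =
        ((ContinuousLinearEquiv.unitsEquiv ℝ Y u : Y ≃L[ℝ] Y) : Y →L[ℝ] Y) x from rfl, this, hu]
    rfl

end CoreA

/-- **Registered helper `helper_fredholmOneAdd`** (Fredholm alternative, `1 + compact` form): an
injective `1 + K` with `K` compact on a real Banach space is a continuous linear equivalence. -/
theorem helper_fredholmOneAdd {Y : Type*} [NormedAddCommGroup Y] [NormedSpace ℝ Y] [CompleteSpace Y]
    (K : Y →L[ℝ] Y) (hK : IsCompactOperator K) (hinj : ∀ x : Y, x + K x = 0 → x = 0) :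
    ∃ L : Y ≃L[ℝ] Y, ∀ x : Y, L x = x + K x :=
  CoreA.exists_continuousLinearEquiv_one_add K hK hinj

end Summit.SmoothPoincare4.SmoothPoincare4.Cruxes.TameOrBrodyR4.Sketch
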